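import Summits.AnomalousDissipation.AnomalousDissipation.Theorems.SolenoidalFractalHomogenisationLagrangianStepCellChainClassicalFrame
import Summits.AnomalousDissipation.AnomalousDissipation.Theorems.SolenoidalFractalHomogenisationLagrangianStepCellChainFastEnergy
import HarnessLib

/-!
# K1L_D `LagrangianRenormalisationStepDesign` (stmt-AnomalousDissipation-27980), registered stub `stub_D1_V0thg` (v28, ruling D28-3 (3)), port-map layer L2:
# the FAST ENERGY of a FROZEN-FRAME distorted weak solution off a finite slow block — a.e. balance and forced decay
# (helper; `--supports stmt-AnomalousDissipation-27980 --as helper`)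

Summits-side helper file of route `SolenoidalFractalHomogenisation` (prover seat `ad-k1l-cellLawV-w1` g9; port map
`Cruxes/LagrangianRenormalisationStepDesign/Lines/onelevel-vtheta-twist-portmap.md` §3 L2, ruling D28-7).  The frozen-frame twin of `…CellChainFastEnergy` §2–§3
for `h : Torus.IsWeakTensorPassiveVectorDistortedOn 0 T 𝔹 (W₁.cell n) (fun _ _ => G₀) F u`, the energy representative of `…CellChainEnergyFrame` (twisted symbol
form `T_{𝔹^{G₀}}`), a frame with `c|k|² ≤ |G₀ᵀk|²` and `0 ≤ lo'` (so the per-mode coercivity is `lo'·c·|k|²`; the gap hypothesis reads `dmin ≤ 8π²·(lo' c)·|k|²`);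
§1 (`gronwall_ac_forced(')`, `absolutelyContinuousOnInterval_finsetSum`) and `…CellChainPair.block_split_le` (generic in the symbol) are REUSED BY NAME.
Everything proved; no definitions, no named facts, no sorry.
* **`ae_hasDerivAt_fastEnergy_le_frame`** — a.e. on `(0,T)`: `Z = E − Σ_{k∈W}‖modeRepθ k‖²` has derivative `−2Q − Σ_{k∈W} 2Re⟪y_k, rhs^θ_k⟫ ≤ −dmin·Z + X`;
* **`fastEnergy_le_of_exchange_le_frame`** — if a.e. `X ≤ (dmin/2)·Z + G` then `Z t ≤ 2G/dmin + e^{−dmin t/2}(Z 0 − 2G/dmin)` on `[0,T]`.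
At `G₀ = 1`, `c = 1` these are the flat statements.
NOT a proof of any registered stub, of the crux, or of anomalous dissipation; rung F-D1 infrastructure for the `stub_D1_V0thg` engine.
-/

set_option linter.dupNamespace false

noncomputable section

namespace Summit.AnomalousDissipation.AnomalousDissipation.Theorems.SolenoidalFractalHomogenisation.LagrangianStep.CellChain

open Set MeasureTheory Filter Topology Function Complex UnitAddTorus
open scoped InnerProductSpace ComplexConjugate
open Literature.Analysis Literature.Analysis.FunctionSpaces Literature.Analysis.FunctionSpaces.Torus
open Literature.Analysis.FluidPDE Literature.Analysis.FluidPDE.Torus Literature.Analysis.FluidPDE.LatticeShear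
open Summit.AnomalousDissipation.AnomalousDissipation.Theorems.SolenoidalFractalHomogenisation.LagrangianStep.W7Engine (gronwall_ac_exp)

variable {k₀ : ℕ}

/-! ## §1 The twisted fast energy: a.e. derivative and dissipation bound -/

set_option maxHeartbeats 800000 in
/-- **The fast energy: a.e. derivative and the dissipation bound.**  For a.e. `t ∈ (0,T)` the fast energy `Z = E − Σ_{k∈W}‖y_k‖²` is
differentiable with derivative `−2Q t − Σ_{k∈W} 2Re⟪y_k t, rhs_k t⟫`, and this value is at most `−dmin·Z t + X t`, `X` the exchange of the block with its
chain neighbours. [cite: BedrossianCotiZelati2017, §2 (hypocoercivity functional with a cross term)] [cite: Temam1984, Ch. III §1 Lemma 1.2] -/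
theorem ae_hasDerivAt_fastEnergy_le_frame (W₁ : LatticeWord k₀) (n : ℕ) {T : ℝ} (hT : 0 ≤ T) {𝔹 : Torus.Visc4 (Fin 3)} {G₀ : Matrix (Fin 3) (Fin 3) ℝ} {lo' hi' : ℝ}
    (h𝔹 : Torus.NearIso 𝔹 lo' hi') (hlo' : 0 ≤ lo')
    {c : ℝ} (hG : ∀ k : Fin 3 → ℤ, c * freqNormSq k ≤ ∑ a, twistFreq G₀ k a ^ 2)
    {F : UnitAddTorus (Fin 3) → EuclideanSpace ℝ (Fin 3)} {u : ℝ → UnitAddTorus (Fin 3) → EuclideanSpace ℝ (Fin 3)}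
    (h : Torus.IsWeakTensorPassiveVectorDistortedOn 0 T 𝔹 (W₁.cell n) (fun _ _ => G₀) F u) (hF : Integrable F volume)
    {E Q : ℝ → ℝ} (hE : ∀ᵐ t ∂(volume.restrict (Ioo 0 T)), E t = ∫ x, ‖u t x‖ ^ 2)
    (hQ : ∀ᵐ t ∂(volume.restrict (Ioo 0 T)), ∀ S : Finset (Fin 3 → ℤ),
      4 * Real.pi ^ 2 * ∑ k ∈ S, (⟪mFourierCoeff (EuclideanSpace.complexify ∘ u t) k,
        Torus.symbT (Torus.Visc4.conj G₀ 𝔹) k (mFourierCoeff (EuclideanSpace.complexify ∘ u t) k)⟫_ℂ).re ≤ Q t)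
    (hEd : ∀ᵐ t ∂(volume : Measure ℝ), t ∈ Ioo 0 T → HasDerivAt E (-(2 * Q t)) t)
    (W : Finset (Fin 3 → ℤ)) {dmin : ℝ} (hdmin : 0 ≤ dmin)
    (hgap : ∀ᵐ t ∂(volume.restrict (Ioo 0 T)), ∀ k : Fin 3 → ℤ, k ∉ W →
      mFourierCoeff (EuclideanSpace.complexify ∘ u t) k ≠ 0 → dmin ≤ 8 * Real.pi ^ 2 * (lo' * c) * freqNormSq k) :
    ∀ᵐ t ∂(volume : Measure ℝ), t ∈ Ioo 0 T →
      HasDerivAt (fun s => E s - ∑ k ∈ W, ‖modeRepθ W₁ n 𝔹 G₀ F u k s‖ ^ 2)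
        (-(2 * Q t) - ∑ k ∈ W, 2 * (⟪modeRepθ W₁ n 𝔹 G₀ F u k t,
          (-(((4 * Real.pi ^ 2 : ℝ) : ℂ) • transversalProjR (twistFreq G₀ k) (Torus.symbT (Torus.majorTranspose (Torus.Visc4.conj G₀ 𝔹)) k (modeRepθ W₁ n 𝔹 G₀ F u k t))) -
          ∑ j, linkCoeff W₁ n k j t • transversalProjR (twistFreq G₀ k)
            ((Complex.exp ((W₁.phase j).φ * Complex.I) * (1 / (2 * ((2 * Real.pi * ‖latticeVec (W₁.phase j).m‖ : ℝ) : ℂ) * Complex.I))) •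
                modeRepθ W₁ n 𝔹 G₀ F u (k - fun i => (W₁.phase j).m i * n) t +
              (starRingEnd ℂ (Complex.exp ((W₁.phase j).φ * Complex.I)) *
                  (-(1 / (2 * ((2 * Real.pi * ‖latticeVec (W₁.phase j).m‖ : ℝ) : ℂ) * Complex.I)))) •
                modeRepθ W₁ n 𝔹 G₀ F u (k + fun i => (W₁.phase j).m i * n) t))⟫_ℂ).re) t ∧
      -(2 * Q t) - ∑ k ∈ W, 2 * (⟪modeRepθ W₁ n 𝔹 G₀ F u k t,
          (-(((4 * Real.pi ^ 2 : ℝ) : ℂ) • transversalProjR (twistFreq G₀ k) (Torus.symbT (Torus.majorTranspose (Torus.Visc4.conj G₀ 𝔹)) k (modeRepθ W₁ n 𝔹 G₀ F u k t))) -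
          ∑ j, linkCoeff W₁ n k j t • transversalProjR (twistFreq G₀ k)
            ((Complex.exp ((W₁.phase j).φ * Complex.I) * (1 / (2 * ((2 * Real.pi * ‖latticeVec (W₁.phase j).m‖ : ℝ) : ℂ) * Complex.I))) •
                modeRepθ W₁ n 𝔹 G₀ F u (k - fun i => (W₁.phase j).m i * n) t +
              (starRingEnd ℂ (Complex.exp ((W₁.phase j).φ * Complex.I)) *
                  (-(1 / (2 * ((2 * Real.pi * ‖latticeVec (W₁.phase j).m‖ : ℝ) : ℂ) * Complex.I)))) •
                modeRepθ W₁ n 𝔹 G₀ F u (k + fun i => (W₁.phase j).m i * n) t))⟫_ℂ).re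
        ≤ -(dmin * (E t - ∑ k ∈ W, ‖modeRepθ W₁ n 𝔹 G₀ F u k t‖ ^ 2)) +
          ∑ k ∈ W, 2 * (⟪modeRepθ W₁ n 𝔹 G₀ F u k t,
            ∑ j, linkCoeff W₁ n k j t • transversalProjR (twistFreq G₀ k)
              ((Complex.exp ((W₁.phase j).φ * Complex.I) * (1 / (2 * ((2 * Real.pi * ‖latticeVec (W₁.phase j).m‖ : ℝ) : ℂ) * Complex.I))) •
                  modeRepθ W₁ n 𝔹 G₀ F u (k - fun i => (W₁.phase j).m i * n) t +
                (starRingEnd ℂ (Complex.exp ((W₁.phase j).φ * Complex.I)) *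
                    (-(1 / (2 * ((2 * Real.pi * ‖latticeVec (W₁.phase j).m‖ : ℝ) : ℂ) * Complex.I)))) •
                  modeRepθ W₁ n 𝔹 G₀ F u (k + fun i => (W₁.phase j).m i * n) t)⟫_ℂ).re := by
  classical
  have hrep := (ae_restrict_iff' measurableSet_Ioo).1 (ae_forall_eq_modeRepθ W₁ n hT h hF)
  have hE' := (ae_restrict_iff' measurableSet_Ioo).1 hE
  have hQ' := (ae_restrict_iff' measurableSet_Ioo).1 hQ
  have hgap' := (ae_restrict_iff' measurableSet_Ioo).1 hgap
  have hmem := (ae_restrict_iff' measurableSet_Ioo).1 h.ae_memLp_two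
  filter_upwards [hrep, hE', hQ', hgap', hmem, hEd] with t hrept hEt hQt hgapt hmemt hEdt htI
  -- notation at time `t`
  set X : (Fin 3 → ℤ) → EuclideanSpace ℂ (Fin 3) := fun k => modeRepθ W₁ n 𝔹 G₀ F u k t with hX
  set L : (Fin 3 → ℤ) → EuclideanSpace ℂ (Fin 3) := fun k => ∑ j, linkCoeff W₁ n k j t • transversalProjR (twistFreq G₀ k)
      ((Complex.exp ((W₁.phase j).φ * Complex.I) * (1 / (2 * ((2 * Real.pi * ‖latticeVec (W₁.phase j).m‖ : ℝ) : ℂ) * Complex.I))) •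
          modeRepθ W₁ n 𝔹 G₀ F u (k - fun i => (W₁.phase j).m i * n) t +
        (starRingEnd ℂ (Complex.exp ((W₁.phase j).φ * Complex.I)) *
            (-(1 / (2 * ((2 * Real.pi * ‖latticeVec (W₁.phase j).m‖ : ℝ) : ℂ) * Complex.I)))) •
          modeRepθ W₁ n 𝔹 G₀ F u (k + fun i => (W₁.phase j).m i * n) t) with hL
  refine ⟨?_, ?_⟩
  · -- the derivative: `E' = −2Q` and the classical derivatives of the slow amplitudes
    have hsum := HasDerivAt.fun_sum (u := W) fun k _ => hasDerivAt_norm_sq_modeRepθ W₁ n h hF k htI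
    exact (hEdt htI).sub hsum
  · -- the bound: block split at `W`
    have hrept' := hrept htI
    have hkdot : ∀ k, rdot (twistFreq G₀ k) (X k) = 0 := fun k => rdot_modeRepθ W₁ n hT h k (Ioo_subset_Icc_self htI)
    have hpars : HasSum (fun k => ‖X k‖ ^ 2) (E t) := by
      have hp := hasSum_sq_norm_mFourierCoeff_complexify (hmemt htI)
      rw [hEt htI]
      refine hp.congr_fun fun k => ?_
      simp only [hX, hrept' k]
    have hblock : ∀ S : Finset (Fin 3 → ℤ), 4 * Real.pi ^ 2 * ∑ k ∈ S, (⟪X k, Torus.symbT (Torus.Visc4.conj G₀ 𝔹) k (X k)⟫_ℂ).re ≤ Q t := by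
      intro S
      have := hQt htI S
      simpa only [hX, hrept'] using this
    have hcoer : ∀ k, lo' * c * (freqNormSq k * ‖X k‖ ^ 2) ≤ (⟪X k, Torus.symbT (Torus.Visc4.conj G₀ 𝔹) k (X k)⟫_ℂ).re := by
      intro k
      have h1 := Torus.lo_mul_le_re_inner_symbT_conj h𝔹 G₀ (hkdot k)
      have h2 : lo' * c * (freqNormSq k * ‖X k‖ ^ 2) ≤ lo' * ((∑ a, twistFreq G₀ k a ^ 2) * ‖X k‖ ^ 2) := by
        rw [mul_assoc, ← mul_assoc c]
        exact mul_le_mul_of_nonneg_left (mul_le_mul_of_nonneg_right (hG k) (sq_nonneg _)) hlo'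
      exact h2.trans h1
    have hgap'' : ∀ k, k ∉ W → X k ≠ 0 → dmin ≤ 8 * Real.pi ^ 2 * (lo' * c) * freqNormSq k := by
      intro k hk hXk
      refine hgapt htI k hk ?_
      rw [hrept' k]; exact hXk
    have hsplit := block_split_le hdmin hpars hblock hcoer W hgap''
    -- the viscous part of `Re⟪y_k, rhs_k⟫`
    have hvisc : ∀ k, (⟪X k, -(((4 * Real.pi ^ 2 : ℝ) : ℂ) • transversalProjR (twistFreq G₀ k) (Torus.symbT (Torus.majorTranspose (Torus.Visc4.conj G₀ 𝔹)) k (X k))) - L k⟫_ℂ).re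
        = -(4 * Real.pi ^ 2 * (⟪X k, Torus.symbT (Torus.Visc4.conj G₀ 𝔹) k (X k)⟫_ℂ).re) - (⟪X k, L k⟫_ℂ).re := by
      intro k
      have hTT : (⟪X k, Torus.symbT (Torus.majorTranspose (Torus.Visc4.conj G₀ 𝔹)) k (X k)⟫_ℂ).re = (⟪X k, Torus.symbT (Torus.Visc4.conj G₀ 𝔹) k (X k)⟫_ℂ).re := by
        rw [← inner_conj_symm, Torus.inner_symbT_majorTranspose_left, Complex.conj_re]
      rw [inner_sub_right, inner_neg_right, inner_smul_right, inner_transversalProjR_right_of_rdot_eq_zero _ (hkdot k),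
        Complex.sub_re, Complex.neg_re, Complex.re_ofReal_mul, hTT]
    have hterm : ∀ k ∈ W, 2 * (⟪X k, -(((4 * Real.pi ^ 2 : ℝ) : ℂ) • transversalProjR (twistFreq G₀ k) (Torus.symbT (Torus.majorTranspose (Torus.Visc4.conj G₀ 𝔹)) k (X k))) - L k⟫_ℂ).re
        = -(2 * (4 * Real.pi ^ 2 * (⟪X k, Torus.symbT (Torus.Visc4.conj G₀ 𝔹) k (X k)⟫_ℂ).re)) - 2 * (⟪X k, L k⟫_ℂ).re := by
      intro k _; rw [hvisc k]; ring
    rw [Finset.sum_congr rfl hterm, Finset.sum_sub_distrib, Finset.sum_neg_distrib, ← Finset.mul_sum, ← Finset.mul_sum]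
    have hZ := hsplit
    nlinarith [hZ, Finset.sum_nonneg fun k (_ : k ∈ W) => sq_nonneg ‖X k‖]


/-! ## §3 Integration: the fast energy under an exchange bound -/

set_option maxHeartbeats 800000 in
/-- **Forced decay of the fast energy.**  If the exchange is a.e. `≤ (dmin/2)·Z + G`, then for every `t ∈ [0,T]`:
`Z t ≤ 2G/dmin + e^{−dmin·t/2}·(Z 0 − 2G/dmin)`, `Z = E − Σ_{k∈W}‖y_k‖²`. [cite: BedrossianCotiZelati2017, §2] [cite: Temam1984, Ch. III §1 Lemma 1.2] -/
theorem fastEnergy_le_of_exchange_le_frame (W₁ : LatticeWord k₀) (n : ℕ) {T : ℝ} (hT : 0 ≤ T) {𝔹 : Torus.Visc4 (Fin 3)} {G₀ : Matrix (Fin 3) (Fin 3) ℝ} {lo' hi' : ℝ}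
    (h𝔹 : Torus.NearIso 𝔹 lo' hi') (hlo' : 0 ≤ lo')
    {c : ℝ} (hG : ∀ k : Fin 3 → ℤ, c * freqNormSq k ≤ ∑ a, twistFreq G₀ k a ^ 2)
    {F : UnitAddTorus (Fin 3) → EuclideanSpace ℝ (Fin 3)} {u : ℝ → UnitAddTorus (Fin 3) → EuclideanSpace ℝ (Fin 3)}
    (h : Torus.IsWeakTensorPassiveVectorDistortedOn 0 T 𝔹 (W₁.cell n) (fun _ _ => G₀) F u) (hF : Integrable F volume)
    {E Q : ℝ → ℝ} (hE : ∀ᵐ t ∂(volume.restrict (Ioo 0 T)), E t = ∫ x, ‖u t x‖ ^ 2)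
    (hQ : ∀ᵐ t ∂(volume.restrict (Ioo 0 T)), ∀ S : Finset (Fin 3 → ℤ),
      4 * Real.pi ^ 2 * ∑ k ∈ S, (⟪mFourierCoeff (EuclideanSpace.complexify ∘ u t) k,
        Torus.symbT (Torus.Visc4.conj G₀ 𝔹) k (mFourierCoeff (EuclideanSpace.complexify ∘ u t) k)⟫_ℂ).re ≤ Q t)
    (hEd : ∀ᵐ t ∂(volume : Measure ℝ), t ∈ Ioo 0 T → HasDerivAt E (-(2 * Q t)) t)
    (hEac : ∀ a ∈ Icc 0 T, ∀ b' ∈ Icc 0 T, AbsolutelyContinuousOnInterval E a b')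
    (W : Finset (Fin 3 → ℤ)) {dmin : ℝ} (hdmin : 0 < dmin)
    (hgap : ∀ᵐ t ∂(volume.restrict (Ioo 0 T)), ∀ k : Fin 3 → ℤ, k ∉ W →
      mFourierCoeff (EuclideanSpace.complexify ∘ u t) k ≠ 0 → dmin ≤ 8 * Real.pi ^ 2 * (lo' * c) * freqNormSq k)
    {G : ℝ} (hX : ∀ᵐ t ∂(volume : Measure ℝ), t ∈ Ioo 0 T →
      ∑ k ∈ W, 2 * (⟪modeRepθ W₁ n 𝔹 G₀ F u k t, (∑ j, linkCoeff W₁ n k j t • transversalProjR (twistFreq G₀ k)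
              ((Complex.exp ((W₁.phase j).φ * Complex.I) * (1 / (2 * ((2 * Real.pi * ‖latticeVec (W₁.phase j).m‖ : ℝ) : ℂ) * Complex.I))) •
                  modeRepθ W₁ n 𝔹 G₀ F u (k - fun i => (W₁.phase j).m i * n) t +
                (starRingEnd ℂ (Complex.exp ((W₁.phase j).φ * Complex.I)) *
                    (-(1 / (2 * ((2 * Real.pi * ‖latticeVec (W₁.phase j).m‖ : ℝ) : ℂ) * Complex.I)))) •
                  modeRepθ W₁ n 𝔹 G₀ F u (k + fun i => (W₁.phase j).m i * n) t))⟫_ℂ).re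
        ≤ dmin / 2 * (E t - ∑ k ∈ W, ‖modeRepθ W₁ n 𝔹 G₀ F u k t‖ ^ 2) + G)
    {t : ℝ} (ht : t ∈ Icc 0 T) :
    E t - ∑ k ∈ W, ‖modeRepθ W₁ n 𝔹 G₀ F u k t‖ ^ 2 ≤
      2 * G / dmin + Real.exp (-(dmin / 2 * t)) * ((E 0 - ∑ k ∈ W, ‖modeRepθ W₁ n 𝔹 G₀ F u k 0‖ ^ 2) - 2 * G / dmin) := by
  classical
  have h0 : (0:ℝ) ∈ Icc 0 T := ⟨le_rfl, hT⟩
  -- absolute continuity of `Z` on `[0,t]`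
  have hZac : AbsolutelyContinuousOnInterval (fun s => E s - ∑ k ∈ W, ‖modeRepθ W₁ n 𝔹 G₀ F u k s‖ ^ 2) 0 t :=
    (hEac 0 h0 t ht).fun_sub (absolutelyContinuousOnInterval_finsetSum W fun k _ =>
      (absolutelyContinuousOnInterval_modeRepθ W₁ n hT h k h0 ht).norm_sq)
  -- the a.e. derivative and its bound, on `uIcc 0 t`
  have hae := ae_hasDerivAt_fastEnergy_le_frame W₁ n hT h𝔹 hlo' hG h hF hE hQ hEd W hdmin.le hgap
  have hae' := ae_uIcc_of_ae_Ioo (P := fun s =>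
      (HasDerivAt (fun s => E s - ∑ k ∈ W, ‖modeRepθ W₁ n 𝔹 G₀ F u k s‖ ^ 2)
        (-(2 * Q s) - ∑ k ∈ W, 2 * (⟪modeRepθ W₁ n 𝔹 G₀ F u k s, (-(((4 * Real.pi ^ 2 : ℝ) : ℂ) • transversalProjR (twistFreq G₀ k) (Torus.symbT (Torus.majorTranspose (Torus.Visc4.conj G₀ 𝔹)) k (modeRepθ W₁ n 𝔹 G₀ F u k s))) -
          ∑ j, linkCoeff W₁ n k j s • transversalProjR (twistFreq G₀ k)
            ((Complex.exp ((W₁.phase j).φ * Complex.I) * (1 / (2 * ((2 * Real.pi * ‖latticeVec (W₁.phase j).m‖ : ℝ) : ℂ) * Complex.I))) •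
                modeRepθ W₁ n 𝔹 G₀ F u (k - fun i => (W₁.phase j).m i * n) s +
              (starRingEnd ℂ (Complex.exp ((W₁.phase j).φ * Complex.I)) *
                  (-(1 / (2 * ((2 * Real.pi * ‖latticeVec (W₁.phase j).m‖ : ℝ) : ℂ) * Complex.I)))) •
                modeRepθ W₁ n 𝔹 G₀ F u (k + fun i => (W₁.phase j).m i * n) s))⟫_ℂ).re) s ∧
      -(2 * Q s) - ∑ k ∈ W, 2 * (⟪modeRepθ W₁ n 𝔹 G₀ F u k s, (-(((4 * Real.pi ^ 2 : ℝ) : ℂ) • transversalProjR (twistFreq G₀ k) (Torus.symbT (Torus.majorTranspose (Torus.Visc4.conj G₀ 𝔹)) k (modeRepθ W₁ n 𝔹 G₀ F u k s))) -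
          ∑ j, linkCoeff W₁ n k j s • transversalProjR (twistFreq G₀ k)
            ((Complex.exp ((W₁.phase j).φ * Complex.I) * (1 / (2 * ((2 * Real.pi * ‖latticeVec (W₁.phase j).m‖ : ℝ) : ℂ) * Complex.I))) •
                modeRepθ W₁ n 𝔹 G₀ F u (k - fun i => (W₁.phase j).m i * n) s +
              (starRingEnd ℂ (Complex.exp ((W₁.phase j).φ * Complex.I)) *
                  (-(1 / (2 * ((2 * Real.pi * ‖latticeVec (W₁.phase j).m‖ : ℝ) : ℂ) * Complex.I)))) •
                modeRepθ W₁ n 𝔹 G₀ F u (k + fun i => (W₁.phase j).m i * n) s))⟫_ℂ).re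
        ≤ -(dmin * (E s - ∑ k ∈ W, ‖modeRepθ W₁ n 𝔹 G₀ F u k s‖ ^ 2)) +
          ∑ k ∈ W, 2 * (⟪modeRepθ W₁ n 𝔹 G₀ F u k s, (∑ j, linkCoeff W₁ n k j s • transversalProjR (twistFreq G₀ k)
              ((Complex.exp ((W₁.phase j).φ * Complex.I) * (1 / (2 * ((2 * Real.pi * ‖latticeVec (W₁.phase j).m‖ : ℝ) : ℂ) * Complex.I))) •
                  modeRepθ W₁ n 𝔹 G₀ F u (k - fun i => (W₁.phase j).m i * n) s +
                (starRingEnd ℂ (Complex.exp ((W₁.phase j).φ * Complex.I)) *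
                    (-(1 / (2 * ((2 * Real.pi * ‖latticeVec (W₁.phase j).m‖ : ℝ) : ℂ) * Complex.I)))) •
                  modeRepθ W₁ n 𝔹 G₀ F u (k + fun i => (W₁.phase j).m i * n) s))⟫_ℂ).re) ∧
      (∑ k ∈ W, 2 * (⟪modeRepθ W₁ n 𝔹 G₀ F u k s, (∑ j, linkCoeff W₁ n k j s • transversalProjR (twistFreq G₀ k)
              ((Complex.exp ((W₁.phase j).φ * Complex.I) * (1 / (2 * ((2 * Real.pi * ‖latticeVec (W₁.phase j).m‖ : ℝ) : ℂ) * Complex.I))) •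
                  modeRepθ W₁ n 𝔹 G₀ F u (k - fun i => (W₁.phase j).m i * n) s +
                (starRingEnd ℂ (Complex.exp ((W₁.phase j).φ * Complex.I)) *
                    (-(1 / (2 * ((2 * Real.pi * ‖latticeVec (W₁.phase j).m‖ : ℝ) : ℂ) * Complex.I)))) •
                  modeRepθ W₁ n 𝔹 G₀ F u (k + fun i => (W₁.phase j).m i * n) s))⟫_ℂ).re
        ≤ dmin / 2 * (E s - ∑ k ∈ W, ‖modeRepθ W₁ n 𝔹 G₀ F u k s‖ ^ 2) + G))
    le_rfl ht.1 ht.2 ((ae_restrict_iff' measurableSet_Ioo).2 (by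
      filter_upwards [hae, hX] with s hs hXs hsI
      exact ⟨hs hsI, hXs hsI⟩))
  have hderiv : ∀ᵐ s ∂(volume : Measure ℝ), s ∈ uIcc 0 t →
      HasDerivAt (fun s => E s - ∑ k ∈ W, ‖modeRepθ W₁ n 𝔹 G₀ F u k s‖ ^ 2)
        (-(2 * Q s) - ∑ k ∈ W, 2 * (⟪modeRepθ W₁ n 𝔹 G₀ F u k s, (-(((4 * Real.pi ^ 2 : ℝ) : ℂ) • transversalProjR (twistFreq G₀ k) (Torus.symbT (Torus.majorTranspose (Torus.Visc4.conj G₀ 𝔹)) k (modeRepθ W₁ n 𝔹 G₀ F u k s))) -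
          ∑ j, linkCoeff W₁ n k j s • transversalProjR (twistFreq G₀ k)
            ((Complex.exp ((W₁.phase j).φ * Complex.I) * (1 / (2 * ((2 * Real.pi * ‖latticeVec (W₁.phase j).m‖ : ℝ) : ℂ) * Complex.I))) •
                modeRepθ W₁ n 𝔹 G₀ F u (k - fun i => (W₁.phase j).m i * n) s +
              (starRingEnd ℂ (Complex.exp ((W₁.phase j).φ * Complex.I)) *
                  (-(1 / (2 * ((2 * Real.pi * ‖latticeVec (W₁.phase j).m‖ : ℝ) : ℂ) * Complex.I)))) •
                modeRepθ W₁ n 𝔹 G₀ F u (k + fun i => (W₁.phase j).m i * n) s))⟫_ℂ).re) s := by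
    filter_upwards [hae'] with s hs hsI
    exact (hs hsI).1.1
  have hineq : ∀ᵐ s ∂(volume : Measure ℝ), s ∈ uIcc 0 t →
      -(2 * Q s) - ∑ k ∈ W, 2 * (⟪modeRepθ W₁ n 𝔹 G₀ F u k s, (-(((4 * Real.pi ^ 2 : ℝ) : ℂ) • transversalProjR (twistFreq G₀ k) (Torus.symbT (Torus.majorTranspose (Torus.Visc4.conj G₀ 𝔹)) k (modeRepθ W₁ n 𝔹 G₀ F u k s))) -
          ∑ j, linkCoeff W₁ n k j s • transversalProjR (twistFreq G₀ k)
            ((Complex.exp ((W₁.phase j).φ * Complex.I) * (1 / (2 * ((2 * Real.pi * ‖latticeVec (W₁.phase j).m‖ : ℝ) : ℂ) * Complex.I))) •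
                modeRepθ W₁ n 𝔹 G₀ F u (k - fun i => (W₁.phase j).m i * n) s +
              (starRingEnd ℂ (Complex.exp ((W₁.phase j).φ * Complex.I)) *
                  (-(1 / (2 * ((2 * Real.pi * ‖latticeVec (W₁.phase j).m‖ : ℝ) : ℂ) * Complex.I)))) •
                modeRepθ W₁ n 𝔹 G₀ F u (k + fun i => (W₁.phase j).m i * n) s))⟫_ℂ).re
        ≤ -(dmin / 2) * (E s - ∑ k ∈ W, ‖modeRepθ W₁ n 𝔹 G₀ F u k s‖ ^ 2) + G := by
    filter_upwards [hae'] with s hs hsI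
    have h1 := (hs hsI).1.2
    have h2 := (hs hsI).2
    linarith
  have key := gronwall_ac_forced (σ := dmin / 2) (G := G) ht.1 (by positivity) hZac hderiv hineq
  have h1 : G / (dmin / 2) = 2 * G / dmin := by field_simp
  have h2 : -(dmin / 2 * (t - 0)) = -(dmin / 2 * t) := by ring
  rw [h1, h2] at key
  exact key

end Summit.AnomalousDissipation.AnomalousDissipation.Theorems.SolenoidalFractalHomogenisation.LagrangianStep.CellChain

end
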